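import Summits.Langlands.Langlands.Theses.QuarterDeficit1951
import Literature.NumberTheory.GaloisRepresentations.GaloisRepUnramifiedProofs
import Literature.NumberTheory.GaloisRepresentations.TateUnramifiedLiftingHolds
import Literature.NumberTheory.GaloisRepresentations.DirichletCharacterOfGaloisCharacter
import Literature.FieldTheory.AlgClosed.PadicAlgClEquivComplex
import Literature.NumberTheory.Automorphic.BCDTTheoremBWildAtThreeDet
import Summits.Langlands.Langlands.Theorems.QuarterDeficit1951IcosahedralSupplyStubIrreducible
import Summits.Langlands.Langlands.Theorems.QuarterDeficit1951IcosahedralSupplyStubConductor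
import Summits.Langlands.Langlands.Theorems.QuarterDeficit1951IcosahedralSupplyStubFrobeniusReadout
import Summits.Langlands.Langlands.Theorems.QuarterDeficit1951IcosahedralSupplyStubTateTwistLift
import Summits.Langlands.Langlands.Theorems.QuarterDeficit1951IcosahedralSupplyStubIcosahedralEmbedding
import Summits.Langlands.Langlands.Theorems.QuarterDeficit1951IcosahedralSupplyDoudMooreField

/-!
# Route `QuarterDeficit1951` (Langlands) — crux `IcosahedralSupply` (stmt-Langlands-15899), line `Sketch`

**The `k`-valued Artin supply** `artinSupply`: for every algebraically closed field `k` of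
characteristic `0` with a Hausdorff ring topology and every `ι : k →+* ℂ`, an irreducible,
finite-image, even `ρ : Γ_ℚ → GL₂(k)` of Artin conductor `1951`, unramified away from `1951`, whose
determinant read through `ι` at arithmetic Frobenius is `χ₀⁻¹` for an order-`5` Dirichlet character
`χ₀` mod `1951`, with the icosahedral Frobenius fingerprint
`t² ∈ {0, d, 4d} ∨ t⁴ − 3dt² + d² = 0`.  Composition of `doudMooreField` with the landed stubs
`stub_icosahedralEmbedding` (`A₅ ↪ PGL₂(k)`), `stub_tateTwistLift` (Tate lifting with ramification
control), `stub_conductor`, `stub_frobeniusReadout`, `stub_irreducible`, and the Cayley–Hamilton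
fingerprint lemma `fingerprint_of_pow_eq_scalar`.
-/

set_option linter.dupNamespace false

noncomputable section

open scoped NumberField MatrixGroups
open Field IsDedekindDomain Polynomial
open Literature.NumberTheory.GaloisRepresentations Literature.NumberTheory.PAdicHodge

namespace Summit.Langlands.Langlands.Theorems.QuarterDeficit1951

/-- **The icosahedral fingerprint is Cayley–Hamilton.** If a power `M ^ m`, `m ∈ {1, 2, 3, 5}`, of a
`2 × 2` matrix over a field is scalar, then `t = tr M`, `d = det M` satisfy
`t² = 0 ∨ t² = d ∨ t² = 4d ∨ t⁴ − 3dt² + d² = 0` (by `M² = tM − d`: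
`M³ = (t² − d)M − td`, `M⁵ = (t⁴ − 3t²d + d²)M − d(t³ − 2td)`, and `aM` scalar with `a ≠ 0` forces
`M` scalar, `t² = 4d`). [folklore] -/
theorem fingerprint_of_pow_eq_scalar {k : Type*} [Field k] (M : Matrix (Fin 2) (Fin 2) k)
    {m : ℕ} (hm : m = 1 ∨ m = 2 ∨ m = 3 ∨ m = 5) (hM : ∃ c : k, Matrix.scalar (Fin 2) c = M ^ m) :
    M.trace ^ 2 = 0 ∨ M.trace ^ 2 = M.det ∨ M.trace ^ 2 = 4 * M.det ∨
      M.trace ^ 4 - 3 * M.det * M.trace ^ 2 + M.det ^ 2 = 0 := by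
  obtain ⟨c, hc⟩ := hM
  have h00 := congr_fun (congr_fun hc 0) 0
  have h01 := congr_fun (congr_fun hc 0) 1
  have h10 := congr_fun (congr_fun hc 1) 0
  have h11 := congr_fun (congr_fun hc 1) 1
  rw [Matrix.trace_fin_two, Matrix.det_fin_two]
  -- `M ^ m = α • M + β • 1` with `α` the candidate invariant; scalar ⇒ `α = 0` or `M` scalar
  have key : ∀ α : k, α * M 0 1 = 0 → α * M 1 0 = 0 → α * (M 0 0 - M 1 1) = 0 →
      α = 0 ∨ (M 0 0 + M 1 1) ^ 2 = 4 * (M 0 0 * M 1 1 - M 0 1 * M 1 0) := by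
    intro α hb hc' had
    by_cases hα : α = 0
    · exact Or.inl hα
    · right
      have hb0 : M 0 1 = 0 := (mul_eq_zero.mp hb).resolve_left hα
      have hc0 : M 1 0 = 0 := (mul_eq_zero.mp hc').resolve_left hα
      have had0 : M 0 0 = M 1 1 := sub_eq_zero.mp ((mul_eq_zero.mp had).resolve_left hα)
      rw [hb0, hc0, had0]; ring
  rcases hm with rfl | rfl | rfl | rfl
  · -- m = 1 : `M` itself is scalar
    simp only [pow_one, Matrix.scalar_apply, Matrix.diagonal_apply_eq, Matrix.diagonal_apply_ne,
      ne_eq, zero_ne_one, one_ne_zero, not_false_eq_true, Fin.isValue] at h00 h01 h10 h11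
    right; right; left
    rw [← h00, ← h01, ← h10, ← h11]; ring
  · simp only [Matrix.scalar_apply, Matrix.diagonal_apply_eq, Matrix.diagonal_apply_ne, ne_eq,
      zero_ne_one, one_ne_zero, not_false_eq_true, Fin.isValue, pow_two, Matrix.mul_apply,
      Fin.sum_univ_two] at h00 h01 h10 h11
    rcases key (M 0 0 + M 1 1) (by linear_combination -h01) (by linear_combination -h10)
      (by linear_combination h11 - h00) with h | h
    · left; rw [h]; ring
    · right; right; left; exact h
  · simp only [Matrix.scalar_apply, Matrix.diagonal_apply_eq, Matrix.diagonal_apply_ne, ne_eq,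
      zero_ne_one, one_ne_zero, not_false_eq_true, Fin.isValue, pow_succ, pow_zero, one_mul,
      Matrix.mul_apply, Fin.sum_univ_two] at h00 h01 h10 h11
    rcases key ((M 0 0 + M 1 1) ^ 2 - (M 0 0 * M 1 1 - M 0 1 * M 1 0))
      (by linear_combination -h01) (by linear_combination -h10)
      (by linear_combination h11 - h00) with h | h
    · right; left; exact sub_eq_zero.mp h
    · right; right; left; exact h
  · simp only [Matrix.scalar_apply, Matrix.diagonal_apply_eq, Matrix.diagonal_apply_ne, ne_eq,
      zero_ne_one, one_ne_zero, not_false_eq_true, Fin.isValue, pow_succ, pow_zero, one_mul,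
      Matrix.mul_apply, Fin.sum_univ_two] at h00 h01 h10 h11
    rcases key ((M 0 0 + M 1 1) ^ 4 - 3 * (M 0 0 * M 1 1 - M 0 1 * M 1 0) * (M 0 0 + M 1 1) ^ 2 +
        (M 0 0 * M 1 1 - M 0 1 * M 1 0) ^ 2)
      (by linear_combination -h01) (by linear_combination -h10)
      (by linear_combination h11 - h00) with h | h
    · right; right; right; exact h
    · right; right; left; exact h

/-- In `A₅` every element has order `1`, `2`, `3` or `5`. [folklore] -/
theorem alternatingGroup_five_pow_eq_one (g : alternatingGroup (Fin 5)) :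
    g = 1 ∨ g ^ 2 = 1 ∨ g ^ 3 = 1 ∨ g ^ 5 = 1 := by
  revert g
  set_option maxRecDepth 100000 in
  decide

/-- **The `k`-valued Artin supply** (all algebraically closed `k` of characteristic `0` with a
Hausdorff ring topology, and any `ι : k →+* ℂ`): an irreducible, finite-image, even
`ρ : Γ_ℚ → GL₂(k)` of Artin conductor `1951`, unramified away from `1951`, whose determinant read
through `ι` at arithmetic Frobenius is `χ₀⁻¹` for an order-`5` Dirichlet character `χ₀` mod `1951`,
with the icosahedral Frobenius fingerprint.  Composition of the stubs. [cite: DoudMoore2006, §2 and §4] -/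
theorem artinSupply (k : Type) [Field k] [IsAlgClosed k] [CharZero k] [TopologicalSpace k]
    [IsTopologicalRing k] [T2Space k] (ι : k →+* ℂ) :
    ∃ ρ : FramedGaloisRep ℚ k 2,
      ρ.toGaloisRep.IsIrreducible ∧ (Set.range ρ).Finite ∧ ρ.IsEven ∧
      ρ.toGaloisRep.artinConductorNat = 1951 ∧
      ∃ χ₀ : DirichletCharacter ℂ 1951, orderOf χ₀ = 5 ∧
        ∀ v : HeightOneSpectrum (𝓞 ℚ), v.residueCard ≠ 1951 →
          ρ.IsUnramifiedAt v ∧ ∃ t d : k,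
            ρ.HasFrobCharpolyAt v (X ^ 2 - C t * X + C d) ∧
            ι d = (χ₀ (v.residueCard : ZMod 1951))⁻¹ ∧
            (t ^ 2 = 0 ∨ t ^ 2 = d ∨ t ^ 2 = 4 * d ∨ t ^ 4 - 3 * d * t ^ 2 + d ^ 2 = 0) := by
  classical
  have hp : Nat.Prime 1951 := by norm_num
  -- the place `v₀ = (1951)` of `ℚ`
  set v₀ : HeightOneSpectrum (𝓞 ℚ) :=
    (Rat.HeightOneSpectrum.primesEquiv (R := 𝓞 ℚ)).symm ⟨1951, hp⟩ with hv₀def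
  have hv₀ : ((1951 : ℕ) : 𝓞 ℚ) ∈ v₀.asIdeal :=
    (Literature.NumberTheory.EllipticCurves.natCast_mem_asIdeal_iff_eq_primesEquiv_symm v₀ hp).mpr
      rfl
  have hres : ∀ v : HeightOneSpectrum (𝓞 ℚ), v.residueCard = 1951 ↔ v = v₀ := by
    intro v
    constructor
    · intro h
      rw [hv₀def, Equiv.eq_symm_apply]
      apply Subtype.ext
      rw [← FramedRep.residueCard_eq_coe_primesEquiv' v, h]
    · rintro rfl
      exact Rat.residueCard_eq_of_natCast_mem hp hv₀
  -- the projective datum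
  obtain ⟨e, he_open, ⟨a, b, hab⟩, he_conj, he_unr, he_loc⟩ := doudMooreField
  obtain ⟨ψ, hψ⟩ := stub_icosahedralEmbedding k
  set ρt : absoluteGaloisGroup ℚ →* PGL(2, k) := ψ.comp e with hρt
  have hρt_apply : ∀ σ, ρt σ = ψ (e σ) := fun σ => rfl
  have hρt_ker : IsOpen ((ρt.ker : Subgroup (absoluteGaloisGroup ℚ)) :
      Set (absoluteGaloisGroup ℚ)) := by
    refine Subgroup.isOpen_mono ?_ he_open
    intro σ hσ
    rw [MonoidHom.mem_ker] at hσ ⊢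
    rw [hρt_apply, hσ, map_one]
  have hρt_unr : ∀ v : HeightOneSpectrum (𝓞 ℚ), v ≠ v₀ →
      ∀ 𝔓 ∈ v.primesAbove, ∀ σ ∈ 𝔓.inertia (absoluteGaloisGroup ℚ), ρt σ = 1 := by
    intro v hv 𝔓 h𝔓 σ hσ
    rw [hρt_apply, he_unr v (fun h => hv ((hres v).mp h)) 𝔓 h𝔓 σ hσ, map_one]
  have hρt_cyc : ∀ 𝔓 ∈ v₀.primesAbove,
      IsCyclic ((𝔓.decompositionSubgroup (absoluteGaloisGroup ℚ)).map ρt) := by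
    intro 𝔓 h𝔓
    obtain ⟨g, -, -, hD⟩ := he_loc v₀ ((hres v₀).mpr rfl) 𝔓 h𝔓
    rw [hρt, ← Subgroup.map_map, hD, MonoidHom.map_zpowers]
    infer_instance
  -- Tate lifting + twist-minimisation
  obtain ⟨ρ, hρ_ker, hlift, hρ_unr, hshape⟩ :=
    stub_tateTwistLift k ρt hρt_ker v₀ hρt_unr hρt_cyc
  -- finite image
  haveI : CompactSpace (absoluteGaloisGroup ℚ) := absoluteGaloisGroup_compactSpace ℚ
  have hfin : (Set.range ρ).Finite := by
    have hq : Finite (absoluteGaloisGroup ℚ ⧸ ρ.toMonoidHom.ker) :=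
      Subgroup.quotient_finite_of_isOpen _ hρ_ker
    have : Finite (ρ.toMonoidHom.range) :=
      Finite.of_equiv _ (QuotientGroup.quotientKerEquivRange ρ.toMonoidHom).toEquiv
    have h : (Set.range ⇑ρ.toMonoidHom).Finite := by
      rw [← MonoidHom.coe_range]; exact Set.finite_coe_iff.mp this
    exact h
  -- powers that are projectively trivial are scalar
  have hcentral : ∀ (σ : absoluteGaloisGroup ℚ) (m : ℕ), (e σ) ^ m = 1 →
      ∃ c : k, Matrix.scalar (Fin 2) c =
        (((ρ σ) ^ m : GL (Fin 2) k) : Matrix (Fin 2) (Fin 2) k) := by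
    intro σ m hm
    have h1 : Matrix.ProjGenLinGroup.mk ((ρ σ) ^ m) = 1 := by
      rw [map_pow, hlift σ, hρt_apply, ← map_pow, hm, map_one]
    rw [Matrix.ProjGenLinGroup.mk_eq_one,
      Matrix.GeneralLinearGroup.mem_center_iff_val_mem_range_scalar] at h1
    exact h1
  -- evenness
  have heven : ρ.IsEven := by
    intro φ c hc
    obtain ⟨r, hr⟩ := hcentral c 1 (by rw [pow_one, he_conj φ c hc])
    rw [pow_one] at hr
    have hsq : (ρ c) * (ρ c) = 1 := by rw [← map_mul, ← sq, hc.sq_eq_one, map_one]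
    have hrr : r * r = 1 := by
      have h := congr_arg (fun g : GL (Fin 2) k => (g : Matrix (Fin 2) (Fin 2) k) 0 0) hsq
      simp only [Units.val_mul, ← hr, Units.val_one] at h
      simpa [Matrix.mul_apply, Fin.sum_univ_two] using h
    apply Units.ext
    rw [Matrix.GeneralLinearGroup.val_det_apply, ← hr, Units.val_one, Matrix.scalar_apply,
      Matrix.det_diagonal, Fin.prod_univ_two, hrr]
  -- irreducibility
  have hirr : ρ.toGaloisRep.IsIrreducible := by
    refine stub_irreducible k ρ hfin ⟨a, b, ?_⟩
    rw [hlift a, hlift b, hρt_apply, hρt_apply]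
    intro h
    exact hab (hψ (by rwa [map_mul, map_mul]))
  -- the inertia shape at `1951`, sharpened: `η` non-trivial with `η⁵ = 1`
  have key : ∀ 𝔓 ∈ v₀.primesAbove, ∃ (P : GL (Fin 2) k)
      (η : 𝔓.inertia (absoluteGaloisGroup ℚ) →* kˣ),
      (∀ τ : 𝔓.inertia (absoluteGaloisGroup ℚ),
        ((ρ (τ : absoluteGaloisGroup ℚ) : GL (Fin 2) k) : Matrix (Fin 2) (Fin 2) k) =
          (P : Matrix (Fin 2) (Fin 2) k) * Matrix.diagonal ![(1 : k), (η τ : k)] *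
            ((P⁻¹ : GL (Fin 2) k) : Matrix (Fin 2) (Fin 2) k)) ∧
      (∃ τ, η τ ≠ 1) ∧ (∀ τ, η τ ^ 5 = 1) := by
    intro 𝔓 h𝔓
    obtain ⟨P, η, hPη⟩ := hshape 𝔓 h𝔓
    obtain ⟨g, hg5, hI, -⟩ := he_loc v₀ ((hres v₀).mpr rfl) 𝔓 h𝔓
    have hPP : ((P⁻¹ : GL (Fin 2) k) : Matrix (Fin 2) (Fin 2) k) * (P : Matrix (Fin 2) (Fin 2) k)
        = 1 := by
      rw [← Units.val_mul, inv_mul_cancel, Units.val_one]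
    -- conjugating back: `P⁻¹ ρ(τ)^m P = diag(1, η τ ^ m)`
    have hpow : ∀ (τ : 𝔓.inertia (absoluteGaloisGroup ℚ)) (m : ℕ),
        ((P⁻¹ : GL (Fin 2) k) : Matrix (Fin 2) (Fin 2) k) *
            (((ρ (τ : absoluteGaloisGroup ℚ)) ^ m : GL (Fin 2) k) : Matrix (Fin 2) (Fin 2) k) *
          (P : Matrix (Fin 2) (Fin 2) k) = Matrix.diagonal ![(1 : k), ((η τ : k)) ^ m] := by
      intro τ m
      induction m with
      | zero =>
        rw [pow_zero, Units.val_one, mul_one, hPP, pow_zero]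
        ext i j; fin_cases i <;> fin_cases j <;> simp
      | succ m ih =>
        rw [pow_succ, Units.val_mul, hPη τ]
        have : ((P⁻¹ : GL (Fin 2) k) : Matrix (Fin 2) (Fin 2) k) *
            ((((ρ (τ : absoluteGaloisGroup ℚ)) ^ m : GL (Fin 2) k) : Matrix (Fin 2) (Fin 2) k) *
              ((P : Matrix (Fin 2) (Fin 2) k) * Matrix.diagonal ![(1 : k), (η τ : k)] *
                ((P⁻¹ : GL (Fin 2) k) : Matrix (Fin 2) (Fin 2) k))) * (P : Matrix (Fin 2) (Fin 2) k)
            = (((P⁻¹ : GL (Fin 2) k) : Matrix (Fin 2) (Fin 2) k) *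
                (((ρ (τ : absoluteGaloisGroup ℚ)) ^ m : GL (Fin 2) k) : Matrix (Fin 2) (Fin 2) k) *
                (P : Matrix (Fin 2) (Fin 2) k)) * Matrix.diagonal ![(1 : k), (η τ : k)] *
              (((P⁻¹ : GL (Fin 2) k) : Matrix (Fin 2) (Fin 2) k) * (P : Matrix (Fin 2) (Fin 2) k)) := by
          simp only [Matrix.mul_assoc]
        rw [this, ih, hPP, Matrix.mul_one, Matrix.diagonal_mul_diagonal, pow_succ]
        congr 1
        ext i; fin_cases i <;> simp
    refine ⟨P, η, hPη, ?_, ?_⟩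
    · -- non-triviality: `g = e τ` for some `τ ∈ I_𝔓`, and `ψ g ≠ 1`
      have hg : g ∈ (𝔓.inertia (absoluteGaloisGroup ℚ)).map e := by
        rw [hI]; exact Subgroup.mem_zpowers g
      obtain ⟨τ, hτ, hτg⟩ := Subgroup.mem_map.mp hg
      refine ⟨⟨τ, hτ⟩, fun h1 => ?_⟩
      have hρτ : ρ τ = 1 := by
        have h := hpow ⟨τ, hτ⟩ 1
        rw [pow_one, pow_one, h1, Units.val_one] at h
        have h' : Matrix.diagonal ![(1 : k), 1] = 1 := by
          ext i j; fin_cases i <;> fin_cases j <;> simp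
        rw [h', ← Units.val_mul, ← Units.val_mul, Units.val_eq_one] at h
        calc ρ τ = P * (P⁻¹ * ρ τ * P) * P⁻¹ := by group
          _ = 1 := by rw [h]; group
      have hg1 : g = 1 := by
        apply hψ
        rw [← hτg, ← hρt_apply, ← hlift τ, map_one, hρτ, map_one]
      rw [hg1, orderOf_one] at hg5
      exact absurd hg5 (by norm_num)
    · -- `η τ ^ 5 = 1`: `(e τ)^5 = 1`, so `ρ(τ)^5` is scalar, and its first eigenvalue is `1`
      intro τ
      have hg5' : g ^ 5 = 1 := orderOf_dvd_iff_pow_eq_one.mp (by rw [hg5])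
      have he5 : (e τ) ^ 5 = 1 := by
        have hmem : e τ ∈ (𝔓.inertia (absoluteGaloisGroup ℚ)).map e :=
          Subgroup.mem_map_of_mem e τ.2
        rw [hI] at hmem
        obtain ⟨i, hi⟩ := Subgroup.mem_zpowers_iff.mp hmem
        rw [← hi, ← zpow_natCast, ← zpow_mul, mul_comm, zpow_mul, zpow_natCast, hg5', one_zpow]
      obtain ⟨c, hc⟩ := hcentral τ 5 he5
      have h := hpow τ 5
      rw [← hc, Matrix.mul_assoc, Matrix.scalar_comm c (fun r' => Commute.all c r'), ← Matrix.mul_assoc,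
        hPP, Matrix.one_mul] at h
      -- compare the two diagonal entries of `scalar c = diag(1, η⁵)`
      have h0 := congr_fun (congr_fun h 0) 0
      have h1 := congr_fun (congr_fun h 1) 1
      simp only [Matrix.scalar_apply, Matrix.diagonal_apply_eq, Fin.isValue,
        Matrix.cons_val_zero, Matrix.cons_val_one] at h0 h1
      apply Units.ext
      rw [Units.val_pow_eq_pow_val, Units.val_one, ← h1, h0]
  -- conductor
  have hcond : ρ.toGaloisRep.artinConductorNat = 1951 := by
    refine stub_conductor k ρ hρ_ker 1951 hp v₀ hv₀ hρ_unr fun 𝔓 h𝔓 => ?_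
    obtain ⟨P, η, hPη, hne, h5⟩ := key 𝔓 h𝔓
    refine ⟨P, η, hPη, hne, fun τ => ?_⟩
    have hdvd : orderOf (η τ) ∣ 5 := orderOf_dvd_of_pow_eq_one (h5 τ)
    exact Nat.Coprime.coprime_dvd_right hdvd (by norm_num)
  -- Frobenius read-out
  obtain ⟨𝔓₀, h𝔓₀⟩ := HeightOneSpectrum.primesAbove_nonempty v₀
  obtain ⟨χ₀, hχ₀, hfrob⟩ := stub_frobeniusReadout k ρ hρ_ker ι v₀ hv₀ hρ_unr
    ⟨𝔓₀, h𝔓₀, key 𝔓₀ h𝔓₀⟩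
  refine ⟨ρ, hirr, hfin, heven, hcond, χ₀, hχ₀, fun v hv => ?_⟩
  have hvne : v ≠ v₀ := fun h => hv ((hres v).mpr h)
  obtain ⟨𝔓₁, σ₀, h𝔓₁, hσ₀, hchar, hdet⟩ := hfrob v hvne
  refine ⟨hρ_unr v hvne, _, _, hchar, hdet, ?_⟩
  -- fingerprint at the Frobenius `σ₀`
  rcases alternatingGroup_five_pow_eq_one (e σ₀) with h | h | h | h
  · exact fingerprint_of_pow_eq_scalar _ (Or.inl rfl) (hcentral σ₀ 1 (by rw [pow_one, h]))
  · exact fingerprint_of_pow_eq_scalar _ (Or.inr (Or.inl rfl)) (hcentral σ₀ 2 h)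
  · exact fingerprint_of_pow_eq_scalar _ (Or.inr (Or.inr (Or.inl rfl))) (hcentral σ₀ 3 h)
  · exact fingerprint_of_pow_eq_scalar _ (Or.inr (Or.inr (Or.inr rfl))) (hcentral σ₀ 5 h)

end Summit.Langlands.Langlands.Theorems.QuarterDeficit1951

end
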